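import Summits.CriticalPhenomena.PercolationContinuityZ3.Theorems.SahiMasterFamilyExPoly
import Mathlib.Combinatorics.Nullstellensatz

/-!
# The top monomial of `E_k`, every `k`: pairwise-dependent families with non-vanishing top Möbius coefficients have `E_k ≢ 0`

Companion of `SahiMasterFamilyExPoly.lean` / `SahiMasterFamilyTopCoeff.lean` (unit `prim-master-conj`; the `k`-uniform
MASTER conjecture `MasterFamilyIdentEqIff k` of `SahiMasterFamilyHeredity.lean`).  The order-3 file proved that for three
functions determined by pairwise-intersecting coordinate sets the top monomial of `E_3` has coefficient the product of the
three top Möbius coefficients.  Here the same is proved for EVERY order `k ≥ 1`, directly from the Lieb–Sahi recursion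
(no set-partition bookkeeping):

* `sahiEPoly k F ∈ ℝ[X_e : e ∈ ι]` — Sahi's `E_k` as a polynomial in the parameters, defined by the tree's recursion for
  `sahiE` with `exPoly` in place of `ex` (`eval_sahiEPoly`); degree `≤ k` in each variable (`degreeOf_sahiEPoly_le`);
* `support_sahiEPoly_le` — if `F_j` is determined by `S_j`, every monomial of `E_k(F)` is `≤ Σ_j X^{S_j}`;
* **`coeff_top_sahiEPoly`** — if moreover the `S_j` PAIRWISE INTERSECT, the coefficient of `Σ_j X^{S_j}` in `E_k(F)` is
  `(−1)^{k−1} ∏_j ĉ_{S_j}(F_j)`.  Induction along `E_{n+2}(f,g) = Σ_i E_{n+1}(g; g_i ↦ g_i f) − E_{n+1}(g)·E(f)`: the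
  modified families cannot reach the top monomial (the slot `g_i f` is determined by `S_i ∪ S_f`, of degree `≤ 1 < 2` in a
  shared variable `e ∈ S_i ∩ S_f`), and the product term contributes `−(−1)^{n} ∏ ĉ`;
* hence (Alon's Nullstellensatz on an interior grid with `k + 1` points per axis) **for every `k ≥ 1`, a family of `k`
  functions determined by pairwise-intersecting sets with non-zero top Möbius coefficients has `E_k(μ_p; F) ≠ 0` for some
  interior `p`** (`sahiE_ne_zero_of_mobCoeff_all`); for events: `sahiENonvanishing_of_mobCoeff`.  Since every member of
  the zero-flag class `Z_k` contains an independent pair, this is the `⇒` direction of `MasterFamilyIdentEqIff k`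
  on the (generic) sub-class "all top Möbius coefficients non-zero" — the first all-`k` case of that direction.
Everything here is proved; axioms standard; no monotonicity is used. [this work]
-/

noncomputable section

open scoped Classical

namespace Summit.CriticalPhenomena.PercolationContinuityZ3.Theorems

open Finset Function MvPolynomial
open Literature.Computability.AlgebraicComplexity (blockProfile blockProfile_apply blockProfile_injective)
open Literature.Combinatorics.Sahi2008
open Literature.Probability.Percolation (DeterminedBy determinedBy_iff)
open Literature.Probability.Percolation.BHK2006 (weight)
open Literature.Probability.Percolation.DecisionTree (ind ind_of_mem ind_of_not_mem ind_nonneg)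

section Poly

variable {ι : Type*} [Fintype ι]

/-! ### `E_k` as a polynomial in the parameters -/

/-- **Sahi's `E_k` as a polynomial in the parameters**, by the Lieb–Sahi recursion of the tree's `sahiE` with the
polynomial expectation `exPoly` in place of `ex`. [this work] -/
def sahiEPoly : (n : ℕ) → (Fin n → Set ι → ℝ) → MvPolynomial ι ℝ
  | 0, _ => 0
  | 1, F => exPoly (F 0)
  | n + 2, F =>
      (∑ i : Fin (n + 1), sahiEPoly (n + 1) (update (Fin.tail F) i (Fin.tail F i * F 0))) -
        sahiEPoly (n + 1) (Fin.tail F) * exPoly (F 0)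

/-- `sahiEPoly` evaluates to `sahiE` under the product weight. [this work] -/
theorem eval_sahiEPoly (x : ι → ℝ) : ∀ (n : ℕ) (F : Fin n → Set ι → ℝ),
    eval x (sahiEPoly n F) = sahiE (weight x) n F
  | 0, F => by simp [sahiEPoly, sahiE_zero]
  | 1, F => by rw [sahiEPoly, sahiE_one_apply, eval_exPoly]
  | n + 2, F => by
    rw [sahiEPoly, sahiE_succ_succ, map_sub, map_mul, map_sum, eval_exPoly, eval_sahiEPoly x (n + 1)]
    simp only [eval_sahiEPoly x (n + 1)]

/-- `E_k` has degree `≤ k` in every variable. [this work] -/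
theorem degreeOf_sahiEPoly_le (e : ι) : ∀ (n : ℕ) (F : Fin n → Set ι → ℝ), degreeOf e (sahiEPoly n F) ≤ n
  | 0, F => by simp [sahiEPoly]
  | 1, F => by rw [sahiEPoly]; exact degreeOf_exPoly_le _ e
  | n + 2, F => by
    rw [sahiEPoly]
    refine (degreeOf_sub_le _ _ _).trans (max_le ?_ ?_)
    · refine (degreeOf_sum_le _ _ _).trans (Finset.sup_le fun i _ => ?_)
      exact (degreeOf_sahiEPoly_le e (n + 1) _).trans (by omega)
    · refine (degreeOf_mul_le _ _ _).trans ?_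
      have h1 := degreeOf_sahiEPoly_le e (n + 1) (Fin.tail F)
      have h2 := degreeOf_exPoly_le (F 0) e
      omega

/-! ### Supports and the top monomial -/

/-- The top exponent `Σ_j X^{S_j}` of a family of determining sets. [this work] -/
def topExp {n : ℕ} (S : Fin n → Finset ι) : ι →₀ ℕ := ∑ j, blockProfile (S j)

omit [Fintype ι] in
/-- Entries of the top exponent: `(Σ_j X^{S_j})_e = #{j : e ∈ S_j}`. [this work] -/
theorem topExp_apply {n : ℕ} (S : Fin n → Finset ι) (e : ι) :
    topExp S e = ∑ j, (if e ∈ S j then 1 else 0) := by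
  simp only [topExp, Finsupp.coe_finsetSum, Finset.sum_apply, blockProfile_apply]

omit [Fintype ι] in
/-- Head/tail splitting of the top exponent. [this work] -/
theorem topExp_succ {n : ℕ} (S : Fin (n + 1) → Finset ι) :
    topExp S = topExp (Fin.tail S) + blockProfile (S 0) := by
  simp only [topExp, Fin.sum_univ_succ, add_comm]; rfl

omit [Fintype ι] in
/-- Entry of the top exponent, one index singled out. [this work] -/
theorem topExp_apply_erase {n : ℕ} (S : Fin n → Finset ι) (i : Fin n) (e : ι) :
    topExp S e = (if e ∈ S i then 1 else 0) + ∑ l ∈ univ.erase i, (if e ∈ S l then 1 else 0) := by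
  rw [topExp_apply, ← add_sum_erase univ _ (mem_univ i)]

omit [Fintype ι] in
/-- The modified family of determining sets (slot `i` enlarged by `T`) singled out at `i`. [this work] -/
theorem topExp_update_apply {n : ℕ} (S : Fin n → Finset ι) (i : Fin n) (T : Finset ι) (e : ι) :
    topExp (update S i (S i ∪ T)) e =
      (if e ∈ S i ∪ T then 1 else 0) + ∑ l ∈ univ.erase i, (if e ∈ S l then 1 else 0) := by
  rw [topExp_apply_erase _ i, update_self]
  congr 1
  refine sum_congr rfl fun l hl => ?_
  rw [update_of_ne (ne_of_mem_erase hl)]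

omit [Fintype ι] in
/-- Enlarging one determining set by `T` keeps the top exponent below `(Σ_j X^{S_j}) + X^T`. [this work] -/
theorem topExp_update_le {n : ℕ} (S : Fin n → Finset ι) (i : Fin n) (T : Finset ι) :
    topExp (update S i (S i ∪ T)) ≤ topExp S + blockProfile T := by
  intro e
  rw [topExp_update_apply, Finsupp.add_apply, topExp_apply_erase S i, blockProfile_apply]
  simp only [mem_union]
  by_cases h1 : e ∈ S i
  · by_cases h2 : e ∈ T <;> simp [h1, h2]
  · by_cases h2 : e ∈ T
    · simp [h1, h2]; omega
    · simp [h1, h2]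

omit [Fintype ι] in
/-- At a variable shared by `S_i` and `T` the enlarged family stays STRICTLY below `(Σ_j X^{S_j}) + X^T`. [this work] -/
theorem not_le_topExp_update {n : ℕ} (S : Fin n → Finset ι) (i : Fin n) (T : Finset ι) {e : ι}
    (hi : e ∈ S i) (hT : e ∈ T) : ¬ topExp S + blockProfile T ≤ topExp (update S i (S i ∪ T)) := by
  intro hle
  have h := hle e
  rw [topExp_update_apply, Finsupp.add_apply, topExp_apply_erase S i, blockProfile_apply] at h
  simp only [mem_union, hi, hT, true_or, if_true] at h
  omega

omit [Fintype ι] in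
/-- A product of two functions determined by `S` and `T` is determined by `S ∪ T`. [folklore] -/
theorem mul_determined {f g : Set ι → ℝ} {S T : Finset ι}
    (hf : ∀ ω ω' : Set ι, ω ∩ ↑S = ω' ∩ ↑S → f ω = f ω')
    (hg : ∀ ω ω' : Set ι, ω ∩ ↑T = ω' ∩ ↑T → g ω = g ω') :
    ∀ ω ω' : Set ι, ω ∩ ↑(S ∪ T) = ω' ∩ ↑(S ∪ T) → (f * g) ω = (f * g) ω' := by
  intro ω ω' h
  rw [coe_union, Set.inter_union_distrib_left, Set.inter_union_distrib_left] at h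
  have hS : ω ∩ ↑S = ω' ∩ ↑S := by
    ext i; constructor
    · rintro ⟨hi, hiS⟩
      have : i ∈ ω' ∩ ↑S ∪ ω' ∩ ↑T := by rw [← h]; exact Or.inl ⟨hi, hiS⟩
      rcases this with h' | h'
      · exact h'
      · exact ⟨h'.1, hiS⟩
    · rintro ⟨hi, hiS⟩
      have : i ∈ ω ∩ ↑S ∪ ω ∩ ↑T := by rw [h]; exact Or.inl ⟨hi, hiS⟩
      rcases this with h' | h'
      · exact h'
      · exact ⟨h'.1, hiS⟩
  have hT : ω ∩ ↑T = ω' ∩ ↑T := by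
    ext i; constructor
    · rintro ⟨hi, hiT⟩
      have : i ∈ ω' ∩ ↑S ∪ ω' ∩ ↑T := by rw [← h]; exact Or.inr ⟨hi, hiT⟩
      rcases this with h' | h'
      · exact ⟨h'.1, hiT⟩
      · exact h'
    · rintro ⟨hi, hiT⟩
      have : i ∈ ω ∩ ↑S ∪ ω ∩ ↑T := by rw [h]; exact Or.inr ⟨hi, hiT⟩
      rcases this with h' | h'
      · exact ⟨h'.1, hiT⟩
      · exact h'
  simp only [Pi.mul_apply, hf ω ω' hS, hg ω ω' hT]

omit [Fintype ι] in
/-- The modified family `g` with `g_i ↦ g_i·f` is determined by the sets `S` with `S_i ↦ S_i ∪ T`. [this work] -/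
theorem update_mul_determined {n : ℕ} {G : Fin n → Set ι → ℝ} {S : Fin n → Finset ι} {f : Set ι → ℝ}
    {T : Finset ι} (hG : ∀ j, ∀ ω ω' : Set ι, ω ∩ ↑(S j) = ω' ∩ ↑(S j) → G j ω = G j ω')
    (hf : ∀ ω ω' : Set ι, ω ∩ ↑T = ω' ∩ ↑T → f ω = f ω') (i : Fin n) :
    ∀ j, ∀ ω ω' : Set ι, ω ∩ ↑(update S i (S i ∪ T) j) = ω' ∩ ↑(update S i (S i ∪ T) j) →
      update G i (G i * f) j ω = update G i (G i * f) j ω' := by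
  intro j
  by_cases hj : j = i
  · subst hj; simp only [update_self]; exact mul_determined (hG j) hf
  · simp only [update_of_ne hj]; exact hG j

/-- **Support bound** (coefficient form): if `F_j` is determined by `S_j` for every `j`, every coefficient of `E_k(F)`
beyond `Σ_j X^{S_j}` vanishes. [this work] -/
theorem coeff_sahiEPoly_eq_zero : ∀ (n : ℕ) (F : Fin n → Set ι → ℝ) (S : Fin n → Finset ι),
    (∀ j, ∀ ω ω' : Set ι, ω ∩ ↑(S j) = ω' ∩ ↑(S j) → F j ω = F j ω') →
      ∀ m, ¬ m ≤ topExp S → coeff m (sahiEPoly n F) = 0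
  | 0, F, S, _ => by simp [sahiEPoly]
  | 1, F, S, hF => by
    intro m hm
    rw [sahiEPoly]
    refine coeff_eq_zero_of_not_le (fun m' hm' => le_blockProfile_of_mem_support_exPoly (hF 0) hm') ?_
    rwa [topExp, Fin.sum_univ_one] at hm
  | n + 2, F, S, hF => by
    intro m hm
    have htailF : ∀ j, ∀ ω ω' : Set ι, ω ∩ ↑(Fin.tail S j) = ω' ∩ ↑(Fin.tail S j) →
        Fin.tail F j ω = Fin.tail F j ω' := fun j => hF j.succ
    rw [sahiEPoly, coeff_sub, coeff_sum]
    have hsum : ∀ i : Fin (n + 1),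
        coeff m (sahiEPoly (n + 1) (update (Fin.tail F) i (Fin.tail F i * F 0))) = 0 := by
      intro i
      refine coeff_sahiEPoly_eq_zero (n + 1) _ _ (update_mul_determined htailF (hF 0) i) m ?_
      intro hle
      exact hm ((hle.trans (topExp_update_le _ i _)).trans (topExp_succ S).symm.le)
    rw [sum_eq_zero fun i _ => hsum i, zero_sub, neg_eq_zero]
    refine coeff_mul_eq_zero_of_not_le (a := topExp (Fin.tail S)) (b := blockProfile (S 0)) ?_ ?_ ?_
    · intro m' hm'
      by_contra h
      exact (mem_support_iff.1 hm') (coeff_sahiEPoly_eq_zero (n + 1) _ _ htailF m' h)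
    · exact fun m' hm' => le_blockProfile_of_mem_support_exPoly (hF 0) hm'
    · rwa [← topExp_succ]

/-- **Support bound**: if `F_j` is determined by `S_j` for every `j`, every monomial of `E_k(F)` is `≤ Σ_j X^{S_j}`.
[this work] -/
theorem support_sahiEPoly_le {n : ℕ} (F : Fin n → Set ι → ℝ) (S : Fin n → Finset ι)
    (hF : ∀ j, ∀ ω ω' : Set ι, ω ∩ ↑(S j) = ω' ∩ ↑(S j) → F j ω = F j ω') :
    ∀ m ∈ (sahiEPoly n F).support, m ≤ topExp S := by
  intro m hm
  by_contra h
  exact (mem_support_iff.1 hm) (coeff_sahiEPoly_eq_zero n F S hF m h)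

/-- **The top-monomial identity, every order.**  If `F_j` is determined by `S_j` (`j < k`, `k ≥ 1`) and the `S_j`
pairwise intersect, the coefficient of `Σ_j X^{S_j}` in `E_k(F)` is `(−1)^{k−1} ∏_j ĉ_{S_j}(F_j)`. [this work] -/
theorem coeff_top_sahiEPoly : ∀ (n : ℕ) (F : Fin (n + 1) → Set ι → ℝ) (S : Fin (n + 1) → Finset ι),
    (∀ j, ∀ ω ω' : Set ι, ω ∩ ↑(S j) = ω' ∩ ↑(S j) → F j ω = F j ω') →
    (∀ j j', j ≠ j' → (S j ∩ S j').Nonempty) →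
      coeff (topExp S) (sahiEPoly (n + 1) F) = (-1) ^ n * ∏ j, mobCoeff (F j) (S j)
  | 0, F, S, hF, _ => by
    rw [sahiEPoly, topExp, Fin.sum_univ_one, Fin.prod_univ_one, coeff_blockProfile_exPoly]
    simp
  | n + 1, F, S, hF, hS => by
    have htailF : ∀ j, ∀ ω ω' : Set ι, ω ∩ ↑(Fin.tail S j) = ω' ∩ ↑(Fin.tail S j) →
        Fin.tail F j ω = Fin.tail F j ω' := fun j => hF j.succ
    have htailS : ∀ j j' : Fin (n + 1), j ≠ j' → (Fin.tail S j ∩ Fin.tail S j').Nonempty :=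
      fun j j' hjj' => hS j.succ j'.succ fun h => hjj' (Fin.succ_injective _ h)
    rw [sahiEPoly, coeff_sub, coeff_sum]
    -- modified families vanish at the top monomial: a shared variable `e ∈ S_0 ∩ S_{i+1}`
    have hmod0 : ∀ i : Fin (n + 1),
        coeff (topExp S) (sahiEPoly (n + 1) (update (Fin.tail F) i (Fin.tail F i * F 0))) = 0 := by
      intro i
      obtain ⟨e, he⟩ := hS i.succ 0 (Fin.succ_ne_zero i)
      refine coeff_sahiEPoly_eq_zero (n + 1) _ _ (update_mul_determined htailF (hF 0) i) _ ?_
      rw [topExp_succ]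
      exact not_le_topExp_update (Fin.tail S) i (S 0) (mem_inter.1 he).1 (mem_inter.1 he).2
    rw [sum_eq_zero fun i _ => hmod0 i, zero_sub]
    -- the product term
    rw [topExp_succ, coeff_add_mul_of_support_le (support_sahiEPoly_le (Fin.tail F) (Fin.tail S) htailF)
      (fun m hm => le_blockProfile_of_mem_support_exPoly (hF 0) (m := m) hm),
      coeff_top_sahiEPoly n (Fin.tail F) (Fin.tail S) htailF htailS, coeff_blockProfile_exPoly]
    have hprod : ∏ j, mobCoeff (F j) (S j) = mobCoeff (F 0) (S 0) * ∏ j : Fin (n + 1),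
        mobCoeff (Fin.tail F j) (Fin.tail S j) := Fin.prod_univ_succ _
    rw [hprod, pow_succ]
    ring

/-! ### Non-vanishing via the Combinatorial Nullstellensatz -/

/-- The grid map `i ↦ (i+1)/(n+2)` on `ℕ` (injective). [folklore] -/
def gridEmb (n : ℕ) : ℕ ↪ ℝ :=
  ⟨fun i => ((i : ℝ) + 1) / ((n : ℝ) + 2), fun i j h => by
    have hn : (0 : ℝ) < (n : ℝ) + 2 := by positivity
    have h' : ((i : ℝ) + 1) = ((j : ℝ) + 1) := by
      have := (div_left_inj' hn.ne').1 h
      exact this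
    exact_mod_cast (add_right_cancel h')⟩

/-- An interior grid with `n + 1` points: `(i+1)/(n+2)`, `i = 0,…,n`. [folklore] -/
def gridPts (n : ℕ) : Finset ℝ := (Finset.range (n + 1)).map (gridEmb n)

omit [Fintype ι] in
/-- The grid has `n + 1` points. [folklore] -/
theorem card_gridPts (n : ℕ) : (gridPts n).card = n + 1 := by
  rw [gridPts, card_map, card_range]

omit [Fintype ι] in
/-- Grid points are interior. [folklore] -/
theorem mem_Ioo_of_mem_gridPts {n : ℕ} {t : ℝ} (ht : t ∈ gridPts n) : t ∈ Set.Ioo (0 : ℝ) 1 := by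
  rw [gridPts, mem_map] at ht
  obtain ⟨i, hi, rfl⟩ := ht
  rw [mem_range] at hi
  simp only [gridEmb, Function.Embedding.coeFn_mk]
  have hn : (0 : ℝ) < (n : ℝ) + 2 := by positivity
  have hi' : (i : ℝ) + 1 < (n : ℝ) + 2 := by
    have : (i : ℝ) < n + 1 := by exact_mod_cast hi
    linarith
  constructor
  · positivity
  · rw [div_lt_one hn]; exact hi'

/-- **`E_k ≠ 0` somewhere in the open cube, every `k ≥ 1`, when the top Möbius coefficients are non-zero.**  For
`k = n + 1` real functions `F_j` on configurations determined by pairwise-intersecting sets `S_j` with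
`∏_j ĉ_{S_j}(F_j) ≠ 0`, some `p ∈ (0,1)^ι` (a grid point) has `E_k(μ_p; F) ≠ 0`. [this work] -/
theorem sahiE_ne_zero_of_mobCoeff_all {n : ℕ} (F : Fin (n + 1) → Set ι → ℝ) (S : Fin (n + 1) → Finset ι)
    (hF : ∀ j, ∀ ω ω' : Set ι, ω ∩ ↑(S j) = ω' ∩ ↑(S j) → F j ω = F j ω')
    (hS : ∀ j j', j ≠ j' → (S j ∩ S j').Nonempty) (hc : ∏ j, mobCoeff (F j) (S j) ≠ 0) :
    ∃ p : ι → unitInterval, (∀ e, (p e : ℝ) ∈ Set.Ioo (0 : ℝ) 1) ∧ sahiE (bernoulliWeight p) (n + 1) F ≠ 0 := by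
  have hne : sahiEPoly (n + 1) F ≠ 0 := by
    intro h0
    have := coeff_top_sahiEPoly n F S hF hS
    rw [h0, coeff_zero] at this
    have h1 : ((-1 : ℝ) ^ n) ≠ 0 := pow_ne_zero _ (by norm_num)
    exact (mul_ne_zero h1 hc) this.symm
  have hex : ∃ x : ι → ℝ, (∀ e, x e ∈ gridPts (n + 1)) ∧ eval x (sahiEPoly (n + 1) F) ≠ 0 := by
    by_contra hall
    push Not at hall
    exact hne (eq_zero_of_eval_zero_at_prod_finset _ (fun _ => gridPts (n + 1))
      (fun e => (degreeOf_sahiEPoly_le e (n + 1) F).trans_lt (by rw [card_gridPts]; omega)) hall)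
  obtain ⟨x, hx, hxne⟩ := hex
  have hx01 : ∀ e, x e ∈ Set.Ioo (0 : ℝ) 1 := fun e => mem_Ioo_of_mem_gridPts (hx e)
  refine ⟨fun e => ⟨x e, (hx01 e).1.le, (hx01 e).2.le⟩, hx01, ?_⟩
  rw [eval_sahiEPoly] at hxne
  exact hxne

end Poly

/-- **Non-vanishing of `E_k` on events with non-zero top Möbius coefficients, every `k ≥ 1`.**  `k` events on a
finite `ι`, determined by pairwise-intersecting coordinate sets `S_j` on which their top Möbius coefficients
`ĉ_{S_j}(1_{U_j})` are non-zero, have `E_k(μ_p; 1_{U_0},…,1_{U_{k−1}}) ≠ 0` for some interior `p`.  (Non-vanishing of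
`ĉ_{S_j}` forces `S_j` to be the essential support, so these are exactly the pairwise-dependent families whose reduced
Euler characteristics are non-zero; no member of the zero-flag class `Z_k` is among them, consistently with
`MasterFamilyIdentEqIff k`, of whose `⇒` direction this is the first all-`k` case.) [this work] -/
theorem sahiENonvanishing_of_mobCoeff {ι : Type} [Fintype ι] {n : ℕ} (U : Fin (n + 1) → Set (Set ι))
    (S : Fin (n + 1) → Finset ι) (hS : ∀ j, DeterminedBy (U j) (↑(S j) : Set ι))
    (hne : ∀ j j', j ≠ j' → (S j ∩ S j').Nonempty) (hc : ∀ j, mobCoeff (ind (U j)) (S j) ≠ 0) :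
    ∃ p : ι → unitInterval, (∀ e, (p e : ℝ) ∈ Set.Ioo (0 : ℝ) 1) ∧
      sahiE (bernoulliWeight p) (n + 1) (fun j => ind (U j)) ≠ 0 :=
  sahiE_ne_zero_of_mobCoeff_all (fun j => ind (U j)) S (fun j => ind_determinedBy (hS j)) hne
    (Finset.prod_ne_zero_iff.2 fun j _ => hc j)

end Summit.CriticalPhenomena.PercolationContinuityZ3.Theorems
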